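import Summits.QuantumFields.BalabanUV.Beta.FP.PeriodisedSymBorderIndexWard
import Summits.QuantumFields.BalabanUV.Beta.GAN24.SymBorderGaugeLegContact

/-!
# `BalabanUV.Beta.FP.PeriodisedSymBorderWardContact` — road «FP» for binder row D1, ROUTE T, the dictionary's (J-a) «THE DOOR AT THE LITERAL OF RECORD (chart
# (III′))», item (α-1b) of an2's `JA-TABLE.v1.md`: **THE PERIODISED SYMMETRISED BORDER TABLE `symVhSAt ρ_c` AGAINST THE TORUS GAUGE MODES IS A CONTACT
# TERM** — the sym twin of `FP/PeriodisedBorderWardContact` §3 (rooted chart): on a residual (non-root) column ONLY THE TIP CONTACT survives,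
# `(Q₁₁^{(κ,u)} · D₁)(a, s) = [s = u + e_κ] · c_j · Q₁₀(a, (u, κ))`, `Q₁₀` the shifted spread's averaging rows `perF M 𝕄_j∘((pμ, inr mμ), fields)`

WHAT.  The generic §2 of `PeriodisedBorderWardContact` (`sum_perZ_dper_mul_tgrad_of_gaugeLeg`: a block-covariant, finitely supported table family with a
FLUCTUATION-leg pure-gauge law, periodised, against the torus gradient columns) is fed the sym letters BY NAME: (TV) `symVhSAt_translate`, the supports
of (α-1) `PeriodisedSymBorderIndexWard.symVhSAt_inr_inl_eq_zero_of_not_mem(_family)` ∕ `linSym04At_inr_inl_eq_zero_of_not_mem`, and gan24-leaf-02's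
fluctuation-leg law `GAN24.SymBorderGaugeLegContact.tsum_symVhSAt_mul_dz` (contact points `u + e_κ` and `x + ρ + L•e_μ`, kernel `linSym04At ρ L`).  §1
**`sum_perZ_dper_symVhSAt_mul_tgrad`** (any box `M = L·M′`, any box root).  §2 at the centred root `ρ_c = ctr (d+1) Lc`: **`tsum_linSym04At_translate_eq`**
(the contact kernel is `c_j ×` the torus averaging row of `𝕄_j = bhKStepSh d Lc (Dsh Lc) j`, `c_j = (Lc^{d+1}·stepScale d Lc j)⁻¹` — (α-1)'s `perZ_linSym04At_eq`
through `perZ_apply`), `perZ_bhKStepSh_inr_inl_of_proj_ne` (off the coarse sublattice the row vanishes), **`sum_perZ_dper_symVhSAt_mul_tgrad_of_not_root`**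
(the far contact point `x + ρ_c + Lc•e_μ` is a ROOT: `PeriodisedBorderWardContact.tdelta_far_eq_zero_of_not_root`), and the matrix forms in the (III′) torus
call's presentation **`submatrix_symVhSAt_mul_tgrad_of_not_root`** (residual columns: the tip contact) and **`submatrix_symVhSAt_mul_tgrad`** (all columns,
both contact points).  Consumed by (α-1b-ii) `PeriodisedSymBorderWardContactInstance.torus_c1_symVhSAt` (the `c1` supplier of (β)) and by the `d1` twin.
[folklore] re-indexing of finitely supported period sums BY NAME; no `def`, no `def … : Prop`, nothing cited, 0 sorry.  Nothing of the dictionary ∕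
Bałaban's asserted.

HONEST DEPENDENCY (page 1, mandatory): continuum YM on T⁴ ⇐ BetaPertH ∧ nine spine estimates (0/9 proved); BetaPertH ⇐ (D1) ∧ (D4) ∧ CAP+tail;
G-an2-4 gates asym, D1 and NE2/3/4.  HONEST FRAMING (cell contract, verbatim): «discharging `BetaPertH` makes Bałaban's UV stability UNCONDITIONAL —
a real constructive-QFT result; it is NOT the continuum limit and NOT the Clay problem.»  ABSOLUTE RULE (cell charter, verbatim): «No internally-minted
statement may enter as a cited fact. Every hypothesis is either kernel-proved in this package or a verbatim quotation of a PUBLISHED theorem with page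
reference. The manuscript(s) under audit are NOT citable for their own disputed steps — they are the thing under adjudication; programme-internal
(2001/route/tribunal) claims are never citable.»  0 estimates; 0∕4 row-D1 binders; NOT (T-ID), NOT (J-a) complete, NOT SDF, NOT D1, NOT BetaPertH, NOT
continuum, NOT Clay.  D1 formalisation swarm LEAF PROVER 02 (b2b-balaban-beta-d1-formalise-leaf-02 gen 21), 2026-08-22.  No existing file touched.
-/

noncomputable section

open scoped BigOperators

namespace Summit.QuantumFields.BalabanUV.Beta.FP.PeriodisedSymBorderWardContact

open Finset
open Literature.Probability.LatticeModels (Torus.proj Torus.proj_apply)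
open Literature.MathematicalPhysics.QuantumFieldTheory.Balaban1983to89
open Literature.MathematicalPhysics.QuantumFieldTheory.Balaban1983to89.Beta
open B4TorusKernel.MultiPeriod (translate translate_apply)
open B6Lemma24Torus (pbox mem_pbox)
open ExpKernelCalculus (MKer shiftK)
open AffineAveraging (Site box toSite unitVec dz)
open AveragingContours (off blk)
open AveragingContoursRooted (ctr ctrOff ctrOff_mem_box)
open OneStepResolventKernel (Fib)
open Summit.QuantumFields.BalabanUV.Beta.BorderedHessian (stepScale stepScale_ne_zero off_eq_zero_iff_proj)
open Summit.QuantumFields.BalabanUV.Beta.DshAn1 (Dsh linSym04At linSym04At_inr_inl)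
open Summit.QuantumFields.BalabanUV.Beta.SymAveragingHessianCounts (symVhSAt symVhSAt_translate)
open Summit.QuantumFields.BalabanUV.Beta.SymShiftedSpread (bhKStepSh)
open Summit.QuantumFields.BalabanUV.Beta.GAN24.SymBorderGaugeLegContact (tsum_symVhSAt_mul_dz)
open Summit.QuantumFields.BalabanUV.Beta.FP.KernelPeriodisationFib (Idx perF perF_apply perZ perZ_apply)
open Summit.QuantumFields.BalabanUV.Beta.FP.KernelPeriodisationFibLoc (dper)
open Summit.QuantumFields.BalabanUV.Beta.FP.TorusGaugeCovariance (tdelta tgrad nearBox mem_nearBox tdelta_eq_zero_of_root)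
open Summit.QuantumFields.BalabanUV.Beta.FP.PeriodisedBorderWardContact (sum_perZ_dper_mul_tgrad_of_gaugeLeg tdelta_far_eq_zero_of_not_root)
open Summit.QuantumFields.BalabanUV.Beta.FP.PeriodisedSymBorderIndexWard (symVhSAt_inr_inl_eq_zero_of_not_mem symVhSAt_inr_inl_eq_zero_of_not_mem_family
  linSym04At_inr_inl_eq_zero_of_not_mem perZ_linSym04At_eq bhKStepSh_Dsh_inr_inl)

variable {d : ℕ}

/-! ## §1 The symmetrised border table, periodised, against the torus gauge modes: a contact term (any box root) -/

section Rooted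

variable {M M' : Fin (d + 1) → ℕ} [∀ μ, NeZero (M μ)] {L : ℕ} [NeZero L] {r : Fin (d + 1) → ℕ}

/-- [folklore] **`sum_perZ_dper_symVhSAt_mul_tgrad` — THE SYMMETRISED BORDER TABLE, PERIODISED, AGAINST A TORUS GAUGE-MODE COLUMN IS A CONTACT TERM**
(`M = L·M′`, box root `toSite r`; sym twin of `PeriodisedBorderWardContact.sum_perZ_dper_vhSAt_mul_tgrad` — the SAME generic `sum_perZ_dper_mul_tgrad_of_gaugeLeg`
fed gan24-leaf-02's fluctuation-leg law `tsum_symVhSAt_mul_dz` and (α-1)'s supports): for the insertion bond `(κ, u)`, the multiplier row `(x, μ)` and any column `s`,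
`Σ_y Σ_α perZ M (dper M (symVhSAt ρ κ u)) x y (inr μ) (inl α) · tgrad M (y, inl α) s = (tdelta M (u + e_κ) s − tdelta M (x + ρ + L•e_μ) s) · Σ'_m linSym04At ρ L x (u + M∘m) (inr μ) (inl κ)`. -/
theorem sum_perZ_dper_symVhSAt_mul_tgrad (hM : ∀ i, M i = L * M' i) (hr : r ∈ box (d + 1) L)
    (κ : Fin (d + 1)) (u x : Site (d + 1)) (μ : Fin (d + 1)) (s : ↥(pbox M)) :
    ∑ y : ↥(pbox M), ∑ α : Fin (d + 1), perZ M (dper M (symVhSAt (toSite r) d L rfl κ u)) x (y : Site (d + 1)) (Sum.inr μ) (Sum.inl α) * tgrad M (y, Sum.inl α) s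
      = (tdelta M (u + unitVec κ) s - tdelta M (x + toSite r + (L : ℤ) • unitVec μ) s)
        * ∑' m : Site (d + 1), linSym04At (toSite r) L x (translate M u m) (Sum.inr μ) (Sum.inl κ) := by
  have hL : 1 ≤ L := Nat.one_le_iff_ne_zero.mpr (NeZero.ne L)
  exact sum_perZ_dper_mul_tgrad_of_gaugeLeg (symVhSAt (toSite r) d L rfl) (fun κ u x μ => linSym04At (toSite r) L x u (Sum.inr μ) (Sum.inl κ))
    (fun x μ => x + toSite r + (L : ℤ) • unitVec μ) (fun x => nearBox L (blk L x)) (fun x => nearBox L (blk L x)) hM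
    (fun κ u t => symVhSAt_translate (toSite r) hL κ u t)
    (fun κ u x μ α z hz => symVhSAt_inr_inl_eq_zero_of_not_mem hr κ u x μ α hz)
    (fun κ x z μ α u hu => symVhSAt_inr_inl_eq_zero_of_not_mem_family hr κ x z μ α hu)
    (fun κ x μ u hu => linSym04At_inr_inl_eq_zero_of_not_mem hr x μ κ hu)
    (fun κ u x μ ψ => tsum_symVhSAt_mul_dz hL hr κ u x μ ψ) κ u x μ s

end Rooted

/-! ## §2 At the centred root `ρ_c`: the contact kernel is `c_j ×` the torus averaging row of the shifted spread `𝕄_j = bhKStepSh d Lc (Dsh Lc) j` -/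

section Centred

variable {M M' : Fin (d + 1) → ℕ} [∀ μ, NeZero (M μ)] {Lc : ℕ} [NeZero Lc]

omit [∀ μ, NeZero (M μ)] in
/-- [folklore] **THE CONTACT KERNEL IS THE TORUS AVERAGING ROW OF THE INSERTION BOND** (sym twin of `tsum_linSymAt_translate_eq`; (α-1)'s `perZ_linSym04At_eq`
read through `perZ_apply`): `Σ'_m linSym04At ρ_c Lc x (u + M∘m) (inr μ) (inl κ) = c_j · perZ M 𝕄_j x u (inr μ) (inl κ)`, `c_j = (Lc^{d+1}·stepScale d Lc j)⁻¹`. -/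
theorem tsum_linSym04At_translate_eq (j : ℕ) (x u : Site (d + 1)) (μ κ : Fin (d + 1)) :
    ∑' m : Site (d + 1), linSym04At (ctr (d + 1) Lc) Lc x (translate M u m) (Sum.inr μ) (Sum.inl κ)
      = ((Lc : ℝ) ^ (d + 1) * stepScale d Lc j)⁻¹ * perZ M (bhKStepSh d Lc (Dsh Lc) j) x u (Sum.inr μ) (Sum.inl κ) := by
  rw [← perZ_apply]
  exact perZ_linSym04At_eq (M := M) j x u μ κ

omit [∀ μ, NeZero (M μ)] in
/-- [folklore] off the coarse sublattice the multiplier row of the periodised shifted spread vanishes on the `(inr, inl)` block. -/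
theorem perZ_bhKStepSh_inr_inl_of_proj_ne (j : ℕ) {x : Site (d + 1)} (hx : Torus.proj Lc x ≠ 0) (u : Site (d + 1)) (μ κ : Fin (d + 1)) :
    perZ M (bhKStepSh d Lc (Dsh Lc) j) x u (Sum.inr μ) (Sum.inl κ) = 0 := by
  have hx' : ¬ off Lc x = 0 := fun h => hx ((off_eq_zero_iff_proj x).1 h)
  rw [perZ_apply]
  refine (tsum_congr fun m => ?_).trans tsum_zero
  rw [bhKStepSh_Dsh_inr_inl, linSym04At_inr_inl, if_neg hx', mul_zero, mul_zero]

/-- [folklore] **ON A RESIDUAL (NON-ROOT) COLUMN ONLY THE TIP CONTACT SURVIVES** (sym twin of `sum_perZ_dper_vhSAt_mul_tgrad_of_not_root`; `M = Lc·M′`, root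
`ρ_c = ctr (d+1) Lc`, column `s` with `proj Lc (s − ρ_c) ≠ 0`):
`Σ_y Σ_α perZ M (dper M (symVhSAt ρ_c κ u)) x y (inr μ) (inl α) · tgrad M (y, inl α) s = tdelta M (u + e_κ) s · c_j · perZ M 𝕄_j x u (inr μ) (inl κ)`. -/
theorem sum_perZ_dper_symVhSAt_mul_tgrad_of_not_root (hM : ∀ i, M i = Lc * M' i) (j : ℕ)
    (κ : Fin (d + 1)) (u x : Site (d + 1)) (μ : Fin (d + 1)) {s : ↥(pbox M)} (hs : Torus.proj Lc ((s : Site (d + 1)) - ctr (d + 1) Lc) ≠ 0) :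
    ∑ y : ↥(pbox M), ∑ α : Fin (d + 1), perZ M (dper M (symVhSAt (ctr (d + 1) Lc) d Lc rfl κ u)) x (y : Site (d + 1)) (Sum.inr μ) (Sum.inl α)
          * tgrad M (y, Sum.inl α) s
      = tdelta M (u + unitVec κ) s * (((Lc : ℝ) ^ (d + 1) * stepScale d Lc j)⁻¹ * perZ M (bhKStepSh d Lc (Dsh Lc) j) x u (Sum.inr μ) (Sum.inl κ)) := by
  have hM' : ∀ i, Lc ∣ M i := fun i => ⟨M' i, hM i⟩
  have hLc : 1 ≤ Lc := Nat.one_le_iff_ne_zero.mpr (NeZero.ne Lc)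
  rw [show ctr (d + 1) Lc = toSite (ctrOff (d + 1) Lc) from rfl, sum_perZ_dper_symVhSAt_mul_tgrad hM (ctrOff_mem_box hLc) κ u x μ s,
    show toSite (ctrOff (d + 1) Lc) = ctr (d + 1) Lc from rfl, tsum_linSym04At_translate_eq (M := M) j x u μ κ]
  by_cases hx : Torus.proj Lc x = 0
  · rw [tdelta_far_eq_zero_of_not_root hM' (ctr (d + 1) Lc) hx μ hs, sub_zero]
  · rw [perZ_bhKStepSh_inr_inl_of_proj_ne (M := M) j hx, mul_zero, mul_zero, mul_zero]

/-- [folklore] **MATRIX FORM IN THE (III′) TORUS CALL's PRESENTATION, RESIDUAL COLUMNS** (field slots `(b.1, inl b.2)`, multiplier slots `a ↦ (pμ a, inr (mμ a))`,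
columns through any `g` landing in NON-ROOT box points): `(Q₁₁^{(κ,u)} * D₁) a c = tdelta M (u + e_κ) (g c) · c_j · Q₁₀ a (u, κ)` with
`Q₁₁^{(κ,u)} := perF M (dper M (symVhSAt ρ_c κ u))∘(fμ,fν)`, `D₁ := tgrad M∘(fν, g)`, `Q₁₀ := perF M 𝕄_j∘(fμ,fν)` — the TIP CONTACT (as for the rooted table, the
static row `c1 : Q₁₁·[D₂|D₁] = 0` is NOT instantiable; the law is the moving-frame letter with the ultralocal generator jet). -/
theorem submatrix_symVhSAt_mul_tgrad_of_not_root (hM : ∀ i, M i = Lc * M' i) (j : ℕ)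
    {μI γ : Type*} (pμ : μI → Site (d + 1)) (hpμ : ∀ a, pμ a ∈ pbox M) (mμ : μI → Fin (d + 1)) (g : γ → ↥(pbox M))
    (hg : ∀ c, Torus.proj Lc ((g c : Site (d + 1)) - ctr (d + 1) Lc) ≠ 0) (κ : Fin (d + 1)) (u : ↥(pbox M)) (a : μI) (c : γ) :
    ((perF M (dper M (symVhSAt (ctr (d + 1) Lc) d Lc rfl κ (u : Site (d + 1))))).submatrix (fun a : μI => ((⟨pμ a, hpμ a⟩, Sum.inr (mμ a)) : Idx M (Fib d)))
          (fun b : ↥(pbox M) × Fin (d + 1) => ((b.1, Sum.inl b.2) : Idx M (Fib d)))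
        * (tgrad M).submatrix (fun b : ↥(pbox M) × Fin (d + 1) => ((b.1, Sum.inl b.2) : Idx M (Fib d))) g) a c
      = tdelta M ((u : Site (d + 1)) + unitVec κ) (g c)
        * ((((Lc : ℝ) ^ (d + 1) * stepScale d Lc j)⁻¹)
          * (perF M (bhKStepSh d Lc (Dsh Lc) j)).submatrix (fun a : μI => ((⟨pμ a, hpμ a⟩, Sum.inr (mμ a)) : Idx M (Fib d)))
              (fun b : ↥(pbox M) × Fin (d + 1) => ((b.1, Sum.inl b.2) : Idx M (Fib d))) a (u, κ)) := by
  rw [Matrix.mul_apply, Fintype.sum_prod_type]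
  simp only [Matrix.submatrix_apply, perF_apply]
  exact sum_perZ_dper_symVhSAt_mul_tgrad_of_not_root hM j κ (u : Site (d + 1)) (pμ a) (mμ a) (hg c)

/-- [folklore] **MATRIX FORM, ALL COLUMNS** (both contact points displayed; ANY column map `g`):
`(Q₁₁^{(κ,u)} * tgrad∘(fν,g)) a c = (tdelta M (u + e_κ) (g c) − tdelta M (pμ a + ρ_c + Lc•e_{mμ a}) (g c)) · c_j · Q₁₀ a (u, κ)` — the block-constant (`D₂`) columns
are finite sums of these (`tgradBlock_eq_sum_tgrad_mul`). -/
theorem submatrix_symVhSAt_mul_tgrad (hM : ∀ i, M i = Lc * M' i) (j : ℕ)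
    {μI γ : Type*} (pμ : μI → Site (d + 1)) (hpμ : ∀ a, pμ a ∈ pbox M) (mμ : μI → Fin (d + 1)) (g : γ → ↥(pbox M))
    (κ : Fin (d + 1)) (u : ↥(pbox M)) (a : μI) (c : γ) :
    ((perF M (dper M (symVhSAt (ctr (d + 1) Lc) d Lc rfl κ (u : Site (d + 1))))).submatrix (fun a : μI => ((⟨pμ a, hpμ a⟩, Sum.inr (mμ a)) : Idx M (Fib d)))
          (fun b : ↥(pbox M) × Fin (d + 1) => ((b.1, Sum.inl b.2) : Idx M (Fib d)))
        * (tgrad M).submatrix (fun b : ↥(pbox M) × Fin (d + 1) => ((b.1, Sum.inl b.2) : Idx M (Fib d))) g) a c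
      = (tdelta M ((u : Site (d + 1)) + unitVec κ) (g c) - tdelta M (pμ a + ctr (d + 1) Lc + (Lc : ℤ) • unitVec (mμ a)) (g c))
        * ((((Lc : ℝ) ^ (d + 1) * stepScale d Lc j)⁻¹)
          * (perF M (bhKStepSh d Lc (Dsh Lc) j)).submatrix (fun a : μI => ((⟨pμ a, hpμ a⟩, Sum.inr (mμ a)) : Idx M (Fib d)))
              (fun b : ↥(pbox M) × Fin (d + 1) => ((b.1, Sum.inl b.2) : Idx M (Fib d))) a (u, κ)) := by
  have hLc : 1 ≤ Lc := Nat.one_le_iff_ne_zero.mpr (NeZero.ne Lc)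
  rw [Matrix.mul_apply, Fintype.sum_prod_type]
  simp only [Matrix.submatrix_apply, perF_apply]
  rw [show ctr (d + 1) Lc = toSite (ctrOff (d + 1) Lc) from rfl, sum_perZ_dper_symVhSAt_mul_tgrad hM (ctrOff_mem_box hLc) κ (u : Site (d + 1)) (pμ a) (mμ a) (g c),
    show toSite (ctrOff (d + 1) Lc) = ctr (d + 1) Lc from rfl, tsum_linSym04At_translate_eq (M := M) j (pμ a) u (mμ a) κ]

end Centred

end Summit.QuantumFields.BalabanUV.Beta.FP.PeriodisedSymBorderWardContact

end
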